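import Literature.Analysis.FunctionSpaces.TorusEnstrophyOrthogonality
import Literature.Analysis.FunctionSpaces.TorusSpaceTime
import HarnessLib

/-!
# Uniform bounds of iterated partial derivatives on the flat torus: a Leibniz calculus

Analysis/FunctionSpaces support file (everything proved; no named facts). In the intermittent
convex-integration schemes (Buckmaster–Vicol, Ann. of Math. 189 (2019), §4 Prop. 4.4 / EMS Surv.
6 (2019), §7.4 (7.22)–(7.24); Luo–Titi, Calc. Var. PDE 59 (2020), §3.2 Prop. 4 and §3.4
Lemma 4 (3.16)) every piece of the perturbation is a finite sum of products
`(amplitude) × (profile) × (profile)` and its `N`-th derivatives are bounded by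
"`λ^N ×` (the height)", `λ` the largest frequency present: "`‖∇^N ∂ₜ^K 𝕎_(ξ)‖ ≲ λ^N (λσrμ)^K r^{3/2-3/p}`"
(Luo–Titi (3.6)), "`‖|∇|^N w_{q+1}‖_{L^p} ≲ r^{3/2-3/p} λ_{q+1}^N 𝒞_{N+1}`" ((3.16)). This file
provides the bookkeeping device for such bounds in sup norm:

* `Torus.iterPartialDeriv l f` — the iterated partial derivative `∂_{l₀} ∂_{l₁} ⋯ f` along a list
  `l` of coordinate directions, with its algebra on smooth functions;
* `Torus.HasDerivBounds n f C L` — `f` is smooth and `‖∂^α f‖_∞ ≤ C L^{|α|}` for all `|α| ≤ n`;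
* closure under `∂ᵢ` (order shifts by one, constant gains a factor `L`), sums, scalar multiples,
  and — the point of the file — **products** (`HasDerivBounds.mul`, `HasDerivBounds.smul`):
  `‖∂^α(fg)‖ ≤ 2^{|α|} C_f C_g L^{|α|}` (Leibniz, by induction on the order), and constants;
* `Torus.exists_hasDerivBounds_of_isSmoothSpaceTimeOn` — a jointly smooth space–time field has,
  uniformly over a compact set of times, bounded space derivatives of every order (`L = 1`): the
  qualitative input "`𝒞_N` is independent of `λ_{q+1}`" (Luo–Titi, end of §3) for the amplitudes;
* read-outs `HasDerivBounds.norm_partialDeriv_le`, `HasDerivBounds.norm_laplacian_partialDeriv_le`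
  (`‖∂ₘf‖ ≤ C L`, `‖Δ∂ₘf‖ ≤ |d| C L³`), the shape consumed by the hyperviscous estimate
  `FluidPDE/FracHyperviscousEstimate`.

## References

* T. Luo, E. S. Titi, Calc. Var. PDE 59 (2020) = arXiv:1808.07595, §3.2 Prop. 4 (3.6),
  §3.4 Lemma 4 (3.16). [`LuoTiti2020`]
* T. Buckmaster, V. Vicol, EMS Surv. Math. Sci. 6 (2019) = arXiv:1901.09023, §7.4 (7.22)–(7.24).
  [`BuckmasterVicol2020`]
-/

noncomputable section

open Set Function

namespace Literature.Analysis.FunctionSpaces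

namespace Torus

variable {d : Type*} [Fintype d] [DecidableEq d]
variable {F : Type*} [NormedAddCommGroup F] [NormedSpace ℝ F]

/-! ## Iterated partial derivatives along a list of directions -/

/-- The iterated partial derivative `∂_{l₀} (∂_{l₁} (⋯ (∂_{lₖ} f)))` of `f : 𝕋^d → F` along the
list `l = [l₀, l₁, …, lₖ]` of coordinate directions (the head is the outermost derivative).
[folklore] -/
def iterPartialDeriv : List d → (UnitAddTorus d → F) → UnitAddTorus d → F
  | [] => fun f => f
  | i :: l => fun f => partialDeriv i (iterPartialDeriv l f)

omit [Fintype d] in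
/-- `∂^{[]} f = f`. [folklore] -/
@[simp] theorem iterPartialDeriv_nil (f : UnitAddTorus d → F) : iterPartialDeriv [] f = f := rfl

omit [Fintype d] in
/-- `∂^{i :: l} f = ∂ᵢ (∂^l f)`. [folklore] -/
@[simp] theorem iterPartialDeriv_cons (i : d) (l : List d) (f : UnitAddTorus d → F) :
    iterPartialDeriv (i :: l) f = partialDeriv i (iterPartialDeriv l f) := rfl

omit [Fintype d] in
/-- `∂^{l₁ ++ l₂} f = ∂^{l₁} (∂^{l₂} f)`. [folklore] -/
theorem iterPartialDeriv_append (l₁ l₂ : List d) (f : UnitAddTorus d → F) :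
    iterPartialDeriv (l₁ ++ l₂) f = iterPartialDeriv l₁ (iterPartialDeriv l₂ f) := by
  induction l₁ with
  | nil => rfl
  | cons i l₁ ih => simp [ih]

omit [Fintype d] in
/-- `∂^{l ++ [i]} f = ∂^l (∂ᵢ f)`. [folklore] -/
theorem iterPartialDeriv_concat (l : List d) (i : d) (f : UnitAddTorus d → F) :
    iterPartialDeriv (l ++ [i]) f = iterPartialDeriv l (partialDeriv i f) := by
  rw [iterPartialDeriv_append]
  rfl

/-- Iterated partial derivatives of smooth functions are smooth. [folklore] -/
theorem IsSmooth.iterPartialDeriv {f : UnitAddTorus d → F} (hf : IsSmooth f) :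
    ∀ l : List d, IsSmooth (iterPartialDeriv l f)
  | [] => hf
  | i :: l => by
    rw [iterPartialDeriv_cons]
    exact (hf.iterPartialDeriv l).partialDeriv i

/-- `∂^l (f + g) = ∂^l f + ∂^l g` for smooth `f`, `g` (pointwise-lambda form). [folklore] -/
theorem iterPartialDeriv_add {f g : UnitAddTorus d → F} (hf : IsSmooth f) (hg : IsSmooth g) :
    ∀ l : List d, iterPartialDeriv l (fun y => f y + g y) =
      fun y => iterPartialDeriv l f y + iterPartialDeriv l g y
  | [] => rfl
  | i :: l => by
    rw [iterPartialDeriv_cons, iterPartialDeriv_add hf hg l, iterPartialDeriv_cons, iterPartialDeriv_cons]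
    have h1 : IsContDiff 1 (iterPartialDeriv l f) := (hf.iterPartialDeriv l).isContDiff (by simp)
    have h2 : IsContDiff 1 (iterPartialDeriv l g) := (hg.iterPartialDeriv l).isContDiff (by simp)
    exact partialDeriv_add h1 h2 i

/-- `∂^l (c • f) = c • ∂^l f` for smooth `f`. [folklore] -/
theorem iterPartialDeriv_const_smul {f : UnitAddTorus d → F} (hf : IsSmooth f) (c : ℝ) :
    ∀ l : List d, iterPartialDeriv l (fun y => c • f y) = fun y => c • iterPartialDeriv l f y
  | [] => rfl
  | i :: l => by
    rw [iterPartialDeriv_cons, iterPartialDeriv_const_smul hf c l, iterPartialDeriv_cons]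
    have h1 : IsContDiff 1 (iterPartialDeriv l f) := (hf.iterPartialDeriv l).isContDiff (by simp)
    exact partialDeriv_const_smul h1 c i

omit [Fintype d] in
/-- `∂^l` of a constant vanishes for `l ≠ []`. [folklore] -/
theorem iterPartialDeriv_const (c : F) : ∀ l : List d, l ≠ [] → iterPartialDeriv l (fun _ : UnitAddTorus d => c) = 0
  | [], h => (h rfl).elim
  | i :: l, _ => by
    rw [iterPartialDeriv_cons]
    by_cases hl : l = []
    · subst hl
      funext y
      simp [FunctionSpaces.Torus.partialDeriv, FunctionSpaces.Torus.lineDeriv]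
    · rw [iterPartialDeriv_const c l hl]
      funext y
      simp [FunctionSpaces.Torus.partialDeriv, FunctionSpaces.Torus.lineDeriv]

/-- `∂^l` of a finite sum of smooth functions. [folklore] -/
theorem iterPartialDeriv_finset_sum {ι : Type*} (s : Finset ι) {f : ι → UnitAddTorus d → F}
    (hf : ∀ i ∈ s, IsSmooth (f i)) (l : List d) :
    iterPartialDeriv l (fun y => ∑ i ∈ s, f i y) = fun y => ∑ i ∈ s, iterPartialDeriv l (f i) y := by
  classical
  induction s using Finset.induction_on with
  | empty =>
    simp only [Finset.sum_empty]
    by_cases hl : l = []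
    · subst hl; rfl
    · exact iterPartialDeriv_const 0 l hl
  | insert a s ha ih =>
    have hfa : IsSmooth (f a) := hf a (Finset.mem_insert_self a s)
    have hfs : ∀ i ∈ s, IsSmooth (f i) := fun i hi => hf i (Finset.mem_insert_of_mem hi)
    have hsum : IsSmooth (fun y => ∑ i ∈ s, f i y) := by
      have h : (fun y => ∑ i ∈ s, f i y) = ∑ i ∈ s, f i := by
        funext y; simp only [Finset.sum_apply]
      rw [h]
      exact Finset.sum_induction _ IsSmooth (fun u v hu hv => hu.add hv) (isSmooth_const 0) hfs
    simp only [Finset.sum_insert ha]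
    rw [iterPartialDeriv_add hfa hsum l, ih hfs]

/-! ## The predicate `HasDerivBounds` -/

/-- **`f` is smooth with `‖∂^α f‖_∞ ≤ C L^{|α|}` for all multi-indices of order `|α| ≤ n`**
(all iterated partial derivatives along lists of length `≤ n`). `L` plays the role of the
largest frequency of `f` ("each derivative costs a factor `λ`", Luo–Titi (3.6), (3.16)).
[cite: LuoTiti2020, §3.2 Prop. 4 (3.6)] -/
def HasDerivBounds (n : ℕ) (f : UnitAddTorus d → F) (C L : ℝ) : Prop :=
  IsSmooth f ∧ ∀ l : List d, l.length ≤ n → ∀ y, ‖iterPartialDeriv l f y‖ ≤ C * L ^ l.length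

namespace HasDerivBounds

variable {n : ℕ} {f g : UnitAddTorus d → F} {C C' L L' : ℝ}

/-- Smoothness. [folklore] -/
theorem isSmooth (h : HasDerivBounds n f C L) : IsSmooth f := h.1

/-- The bound. [folklore] -/
theorem bound (h : HasDerivBounds n f C L) {l : List d} (hl : l.length ≤ n) (y : UnitAddTorus d) :
    ‖iterPartialDeriv l f y‖ ≤ C * L ^ l.length := h.2 l hl y

/-- Order zero: `‖f y‖ ≤ C`. [folklore] -/
theorem norm_le (h : HasDerivBounds n f C L) (y : UnitAddTorus d) : ‖f y‖ ≤ C := by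
  have := h.2 [] (by simp) y
  simpa using this

/-- The constant is non-negative. [folklore] -/
theorem nonneg (h : HasDerivBounds n f C L) : 0 ≤ C := (norm_nonneg _).trans (h.norm_le 0)

/-- Lowering the order. [folklore] -/
theorem of_le (h : HasDerivBounds n f C L) {m : ℕ} (hm : m ≤ n) : HasDerivBounds m f C L :=
  ⟨h.1, fun l hl y => h.2 l (hl.trans hm) y⟩

/-- Lowering the order by one. [folklore] -/
theorem of_succ (h : HasDerivBounds (n + 1) f C L) : HasDerivBounds n f C L := h.of_le (Nat.le_succ n)

/-- Enlarging the constants (`0 ≤ L ≤ L'`, `C ≤ C'`). [folklore] -/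
theorem mono (h : HasDerivBounds n f C L) (hC : C ≤ C') (hL : 0 ≤ L) (hL' : L ≤ L') :
    HasDerivBounds n f C' L' :=
  ⟨h.1, fun l hl y => (h.2 l hl y).trans
    (mul_le_mul hC (pow_le_pow_left₀ hL hL' _) (pow_nonneg hL _) (h.nonneg.trans hC))⟩

/-- **One derivative: `∂ᵢ f` has bounds of order `n` with constant `C L`** if `f` has bounds of
order `n + 1`. [folklore] -/
theorem partialDeriv (h : HasDerivBounds (n + 1) f C L) (i : d) :
    HasDerivBounds n (Torus.partialDeriv i f) (C * L) L := by
  refine ⟨h.1.partialDeriv i, fun l hl y => ?_⟩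
  have := h.2 (l ++ [i]) (by simpa using hl) y
  rw [iterPartialDeriv_concat] at this
  calc ‖iterPartialDeriv l (Torus.partialDeriv i f) y‖ ≤ C * L ^ (l ++ [i]).length := this
    _ = C * L * L ^ l.length := by rw [List.length_append, List.length_singleton, pow_succ]; ring

/-- First-order read-out: `‖∂ᵢ f‖ ≤ C L`. [folklore] -/
theorem norm_partialDeriv_le (h : HasDerivBounds n f C L) (hn : 1 ≤ n) (i : d) (y : UnitAddTorus d) :
    ‖Torus.partialDeriv i f y‖ ≤ C * L := by
  have := h.2 [i] (by simpa using hn) y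
  simpa using this

/-- Third-order read-out: `‖Δ(∂ₘ f)‖ ≤ |d| C L³` (`Δ = ∑ᵢ∂ᵢ∂ᵢ` on smooth functions). [folklore] -/
theorem norm_laplacian_partialDeriv_le (h : HasDerivBounds n f C L) (hn : 3 ≤ n) (m : d)
    (y : UnitAddTorus d) : ‖Torus.laplacian (Torus.partialDeriv m f) y‖ ≤ Fintype.card d * (C * L ^ 3) := by
  rw [laplacian_eq_sum_partialDeriv_partialDeriv (h.1.partialDeriv m) y]
  calc ‖∑ i, Torus.partialDeriv i (Torus.partialDeriv i (Torus.partialDeriv m f)) y‖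
      ≤ ∑ i, ‖Torus.partialDeriv i (Torus.partialDeriv i (Torus.partialDeriv m f)) y‖ := norm_sum_le _ _
    _ ≤ ∑ _i : d, C * L ^ 3 := Finset.sum_le_sum fun i _ => by
        have := h.2 [i, i, m] (by simpa using hn) y
        simpa using this
    _ = Fintype.card d * (C * L ^ 3) := by rw [Finset.sum_const, Finset.card_univ, nsmul_eq_mul]

/-- Sums. [folklore] -/
theorem add {Cf Cg : ℝ} (hf : HasDerivBounds n f Cf L) (hg : HasDerivBounds n g Cg L) :
    HasDerivBounds n (fun y => f y + g y) (Cf + Cg) L := by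
  refine ⟨hf.1.add hg.1, fun l hl y => ?_⟩
  rw [iterPartialDeriv_add hf.1 hg.1 l]
  calc ‖iterPartialDeriv l f y + iterPartialDeriv l g y‖
      ≤ ‖iterPartialDeriv l f y‖ + ‖iterPartialDeriv l g y‖ := norm_add_le _ _
    _ ≤ Cf * L ^ l.length + Cg * L ^ l.length := add_le_add (hf.2 l hl y) (hg.2 l hl y)
    _ = (Cf + Cg) * L ^ l.length := by ring

/-- Scalar multiples by a constant. [folklore] -/
theorem const_smul (hf : HasDerivBounds n f C L) (c : ℝ) :
    HasDerivBounds n (fun y => c • f y) (|c| * C) L := by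
  refine ⟨hf.1.smul c, fun l hl y => ?_⟩
  rw [iterPartialDeriv_const_smul hf.1 c l]
  calc ‖c • iterPartialDeriv l f y‖ = |c| * ‖iterPartialDeriv l f y‖ := by rw [norm_smul, Real.norm_eq_abs]
    _ ≤ |c| * (C * L ^ l.length) := mul_le_mul_of_nonneg_left (hf.2 l hl y) (abs_nonneg c)
    _ = |c| * C * L ^ l.length := by ring

/-- Negation. [folklore] -/
theorem neg (hf : HasDerivBounds n f C L) : HasDerivBounds n (fun y => -f y) C L := by
  have h := hf.const_smul (-1)
  simp only [neg_smul, one_smul, abs_neg, abs_one, one_mul] at h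
  exact h

/-- Finite sums. [folklore] -/
theorem sum {ι : Type*} (s : Finset ι) {f : ι → UnitAddTorus d → F} {Cf : ι → ℝ}
    (h : ∀ i ∈ s, HasDerivBounds n (f i) (Cf i) L) :
    HasDerivBounds n (fun y => ∑ i ∈ s, f i y) (∑ i ∈ s, Cf i) L := by
  classical
  induction s using Finset.induction_on with
  | empty =>
    refine ⟨isSmooth_const 0, fun l hl y => ?_⟩
    by_cases hl0 : l = []
    · subst hl0; simp
    · have : iterPartialDeriv l (fun _ : UnitAddTorus d => (0 : F)) = 0 := iterPartialDeriv_const 0 l hl0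
      simp only [Finset.sum_empty]
      rw [this]
      simp
  | insert a s ha ih =>
    have hfa := h a (Finset.mem_insert_self a s)
    have hfs := ih fun i hi => h i (Finset.mem_insert_of_mem hi)
    simp only [Finset.sum_insert ha]
    exact hfa.add hfs

end HasDerivBounds

/-- Constants: `HasDerivBounds n (fun _ => c) ‖c‖ L` for `L ≥ 0`. [folklore] -/
theorem hasDerivBounds_const (n : ℕ) (c : F) {L : ℝ} (hL : 0 ≤ L) :
    HasDerivBounds n (fun _ : UnitAddTorus d => c) ‖c‖ L := by
  refine ⟨isSmooth_const c, fun l _ y => ?_⟩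
  by_cases hl : l = []
  · subst hl; simp
  · rw [iterPartialDeriv_const c l hl]
    simp only [Pi.zero_apply, norm_zero]
    positivity

/-! ## Products (Leibniz) -/

/-- Decomposing a list of length `n + 1` as `l' ++ [i]` with `l'.length = n`. [folklore] -/
theorem List.exists_eq_concat_of_length_eq_succ {α : Type*} {l : List α} {n : ℕ}
    (h : l.length = n + 1) : ∃ (l' : List α) (i : α), l = l' ++ [i] ∧ l'.length = n := by
  have hne : l ≠ [] := by rintro rfl; simp at h
  refine ⟨l.dropLast, l.getLast hne, (List.dropLast_append_getLast hne).symm, ?_⟩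
  rw [List.length_dropLast, h]
  rfl

/-- **Leibniz bound for products of real functions**: if `f`, `g` have derivative bounds of order
`n` with constants `(C_f, L)`, `(C_g, L)`, `L ≥ 0`, then `fg` has derivative bounds of order `n`
with constant `2ⁿ C_f C_g` (by induction on `n`: `∂^{l'++[i]}(fg) = ∂^{l'}(f ∂ᵢg) + ∂^{l'}(∂ᵢf g)`).
[folklore] -/
theorem HasDerivBounds.mul {n : ℕ} :
    ∀ {f g : UnitAddTorus d → ℝ} {Cf Cg L : ℝ}, HasDerivBounds n f Cf L → HasDerivBounds n g Cg L →
      0 ≤ L → HasDerivBounds n (fun y => f y * g y) (2 ^ n * Cf * Cg) L := by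
  induction n with
  | zero =>
    intro f g Cf Cg L hf hg hL
    refine ⟨(ContDiff.mul hf.1 hg.1 : IsSmooth fun y => f y * g y), fun l hl y => ?_⟩
    have hl0 : l = [] := List.eq_nil_of_length_eq_zero (Nat.le_zero.1 hl)
    subst hl0
    simp only [iterPartialDeriv_nil, pow_zero, one_mul, List.length_nil, mul_one]
    rw [norm_mul]
    exact mul_le_mul (hf.norm_le y) (hg.norm_le y) (norm_nonneg _) hf.nonneg
  | succ n ih =>
    intro f g Cf Cg L hf hg hL
    have hsm : IsSmooth fun y => f y * g y := (ContDiff.mul hf.1 hg.1 : IsSmooth fun y => f y * g y)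
    refine ⟨hsm, fun l hl y => ?_⟩
    have hCf := hf.nonneg
    have hCg := hg.nonneg
    rcases Nat.lt_or_ge l.length (n + 1) with hlt | hge
    · have h := (ih hf.of_succ hg.of_succ hL).2 l (Nat.lt_succ_iff.1 hlt) y
      refine h.trans ?_
      have : (2 : ℝ) ^ n ≤ 2 ^ (n + 1) := pow_le_pow_right₀ (by norm_num) (Nat.le_succ n)
      have hLk : 0 ≤ L ^ l.length := pow_nonneg hL _
      nlinarith [mul_nonneg (mul_nonneg hCf hCg) hLk]
    · have hlen : l.length = n + 1 := le_antisymm hl hge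
      obtain ⟨l', i, rfl, hlen'⟩ := List.exists_eq_concat_of_length_eq_succ hlen
      rw [iterPartialDeriv_concat]
      have h1f : IsContDiff 1 f := hf.1.isContDiff (by simp)
      have h1g : IsContDiff 1 g := hg.1.isContDiff (by simp)
      have hprod : Torus.partialDeriv i (fun y => f y * g y) =
          fun y => f y * Torus.partialDeriv i g y + Torus.partialDeriv i f y * g y :=
        funext fun y => partialDeriv_mul h1f h1g i y
      have hA : IsSmooth fun y => f y * Torus.partialDeriv i g y :=
        (ContDiff.mul hf.1 (hg.1.partialDeriv i) : IsSmooth fun y => f y * Torus.partialDeriv i g y)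
      have hB : IsSmooth fun y => Torus.partialDeriv i f y * g y :=
        (ContDiff.mul (hf.1.partialDeriv i) hg.1 : IsSmooth fun y => Torus.partialDeriv i f y * g y)
      rw [hprod, iterPartialDeriv_add hA hB l']
      have e1 := (ih hf.of_succ (hg.partialDeriv i) hL).2 l' hlen'.le y
      have e2 := (ih (hf.partialDeriv i) hg.of_succ hL).2 l' hlen'.le y
      rw [hlen'] at e1 e2
      calc ‖iterPartialDeriv l' (fun y => f y * Torus.partialDeriv i g y) y +
            iterPartialDeriv l' (fun y => Torus.partialDeriv i f y * g y) y‖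
          ≤ 2 ^ n * Cf * (Cg * L) * L ^ n + 2 ^ n * (Cf * L) * Cg * L ^ n :=
            (norm_add_le _ _).trans (add_le_add e1 e2)
        _ = 2 ^ (n + 1) * Cf * Cg * L ^ (l' ++ [i]).length := by
            rw [List.length_append, List.length_singleton, hlen']
            ring

/-- **Leibniz bound for a real function times a vector function** (`f • g`), same statement as
`HasDerivBounds.mul`. [folklore] -/
theorem HasDerivBounds.smul {n : ℕ} :
    ∀ {f : UnitAddTorus d → ℝ} {g : UnitAddTorus d → F} {Cf Cg L : ℝ}, HasDerivBounds n f Cf L →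
      HasDerivBounds n g Cg L → 0 ≤ L → HasDerivBounds n (fun y => f y • g y) (2 ^ n * Cf * Cg) L := by
  induction n with
  | zero =>
    intro f g Cf Cg L hf hg hL
    refine ⟨hf.1.smul' hg.1, fun l hl y => ?_⟩
    have hl0 : l = [] := List.eq_nil_of_length_eq_zero (Nat.le_zero.1 hl)
    subst hl0
    simp only [iterPartialDeriv_nil, pow_zero, one_mul, List.length_nil, mul_one]
    rw [norm_smul]
    exact mul_le_mul (hf.norm_le y) (hg.norm_le y) (norm_nonneg _) hf.nonneg
  | succ n ih =>
    intro f g Cf Cg L hf hg hL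
    refine ⟨hf.1.smul' hg.1, fun l hl y => ?_⟩
    have hCf := hf.nonneg
    have hCg := hg.nonneg
    rcases Nat.lt_or_ge l.length (n + 1) with hlt | hge
    · have h := (ih hf.of_succ hg.of_succ hL).2 l (Nat.lt_succ_iff.1 hlt) y
      refine h.trans ?_
      have : (2 : ℝ) ^ n ≤ 2 ^ (n + 1) := pow_le_pow_right₀ (by norm_num) (Nat.le_succ n)
      have hLk : 0 ≤ L ^ l.length := pow_nonneg hL _
      nlinarith [mul_nonneg (mul_nonneg hCf hCg) hLk]
    · have hlen : l.length = n + 1 := le_antisymm hl hge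
      obtain ⟨l', i, rfl, hlen'⟩ := List.exists_eq_concat_of_length_eq_succ hlen
      rw [iterPartialDeriv_concat]
      have h1f : IsContDiff 1 f := hf.1.isContDiff (by simp)
      have h1g : IsContDiff 1 g := hg.1.isContDiff (by simp)
      have hprod : Torus.partialDeriv i (fun y => f y • g y) =
          fun y => f y • Torus.partialDeriv i g y + Torus.partialDeriv i f y • g y :=
        funext fun y => partialDeriv_smul h1f h1g i y
      have hA : IsSmooth fun y => f y • Torus.partialDeriv i g y := hf.1.smul' (hg.1.partialDeriv i)
      have hB : IsSmooth fun y => Torus.partialDeriv i f y • g y := (hf.1.partialDeriv i).smul' hg.1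
      rw [hprod, iterPartialDeriv_add hA hB l']
      have e1 := (ih hf.of_succ (hg.partialDeriv i) hL).2 l' hlen'.le y
      have e2 := (ih (hf.partialDeriv i) hg.of_succ hL).2 l' hlen'.le y
      rw [hlen'] at e1 e2
      calc ‖iterPartialDeriv l' (fun y => f y • Torus.partialDeriv i g y) y +
            iterPartialDeriv l' (fun y => Torus.partialDeriv i f y • g y) y‖
          ≤ 2 ^ n * Cf * (Cg * L) * L ^ n + 2 ^ n * (Cf * L) * Cg * L ^ n :=
            (norm_add_le _ _).trans (add_le_add e1 e2)
        _ = 2 ^ (n + 1) * Cf * Cg * L ^ (l' ++ [i]).length := by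
            rw [List.length_append, List.length_singleton, hlen']
            ring

/-! ## Qualitative bounds from joint smoothness on a compact set of times -/

/-- The iterated spatial derivative of a jointly smooth space–time field is jointly smooth. [folklore] -/
theorem IsSmoothSpaceTimeOn.iterPartialDeriv {S : Set ℝ} {u : ℝ → UnitAddTorus d → F}
    (hu : IsSmoothSpaceTimeOn S u) (hS : UniqueDiffOn ℝ S) :
    ∀ l : List d, IsSmoothSpaceTimeOn S (fun t => iterPartialDeriv l (u t))
  | [] => hu
  | i :: l => by
    simp only [iterPartialDeriv_cons]
    exact (hu.iterPartialDeriv hS l).partialDeriv hS i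

/-- **Uniform bounds of all space derivatives up to order `n` of a jointly smooth field, over a
compact set of times.** [folklore] -/
theorem exists_forall_norm_iterPartialDeriv_le {S : Set ℝ} (hS : UniqueDiffOn ℝ S) {K : Set ℝ}
    (hK : IsCompact K) (hKS : K ⊆ S) (n : ℕ) :
    ∀ {u : ℝ → UnitAddTorus d → F}, IsSmoothSpaceTimeOn S u →
      ∃ C : ℝ, 0 ≤ C ∧ ∀ t ∈ K, ∀ l : List d, l.length ≤ n → ∀ y, ‖iterPartialDeriv l (u t) y‖ ≤ C := by
  induction n with
  | zero =>
    intro u hu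
    obtain ⟨C, hC⟩ := hu.exists_norm_le_of_isCompact hK hKS
    refine ⟨max C 0, le_max_right _ _, fun t ht l hl y => ?_⟩
    have hl0 : l = [] := List.eq_nil_of_length_eq_zero (Nat.le_zero.1 hl)
    subst hl0
    exact (hC t ht y).trans (le_max_left _ _)
  | succ n ih =>
    intro u hu
    obtain ⟨C₀, hC₀, h₀⟩ := ih hu
    choose Ci hCi hi using fun i : d => ih (hu.partialDeriv hS i)
    refine ⟨C₀ + ∑ i, Ci i, add_nonneg hC₀ (Finset.sum_nonneg fun i _ => hCi i), fun t ht l hl y => ?_⟩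
    have hsum : ∀ j, Ci j ≤ C₀ + ∑ i, Ci i := fun j =>
      le_add_of_nonneg_of_le hC₀ (Finset.single_le_sum (fun i _ => hCi i) (Finset.mem_univ j))
    rcases Nat.lt_or_ge l.length (n + 1) with hlt | hge
    · exact (h₀ t ht l (Nat.lt_succ_iff.1 hlt) y).trans (le_add_of_nonneg_right (Finset.sum_nonneg fun i _ => hCi i))
    · have hlen : l.length = n + 1 := le_antisymm hl hge
      obtain ⟨l', i, rfl, hlen'⟩ := List.exists_eq_concat_of_length_eq_succ hlen
      rw [iterPartialDeriv_concat]
      exact (hi i t ht l' hlen'.le y).trans (hsum i)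

/-- **A jointly smooth field has, uniformly over a compact set of times `K ⊆ S`, derivative
bounds of every order with `L = 1`**: `∃ C, ∀ t ∈ K, HasDerivBounds n (u t) C 1`. This is the
qualitative input "`𝒞_N` (polynomials in `‖a_ξ‖_{C^N}`) is independent of `λ_{q+1}`" of Luo–Titi
(end of §3) for the amplitude functions of the scheme. [cite: LuoTiti2020, §3.4 Lemma 2 (3.12)] -/
theorem exists_hasDerivBounds_of_isSmoothSpaceTimeOn {S : Set ℝ} (hS : UniqueDiffOn ℝ S) {K : Set ℝ}
    (hK : IsCompact K) (hKS : K ⊆ S) (n : ℕ) {u : ℝ → UnitAddTorus d → F}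
    (hu : IsSmoothSpaceTimeOn S u) :
    ∃ C : ℝ, 0 ≤ C ∧ ∀ t ∈ K, HasDerivBounds n (u t) C 1 := by
  obtain ⟨C, hC, h⟩ := exists_forall_norm_iterPartialDeriv_le hS hK hKS n hu
  exact ⟨C, hC, fun t ht => ⟨hu.isSmooth_slice (hKS ht), fun l hl y => by
    rw [one_pow, mul_one]; exact h t ht l hl y⟩⟩

end Torus

end Literature.Analysis.FunctionSpaces
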